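import Mathlib
import Summits.NavierStokesRegularity.NavierStokesRegularity.Theorems.HeteroclinicTriggerChainTriggerChainFrontStepForcedArcWithin
import Summits.NavierStokesRegularity.NavierStokesRegularity.Theorems.HeteroclinicTriggerChainTriggerChainFrontStepForcedDelay
import Summits.NavierStokesRegularity.NavierStokesRegularity.Theorems.HeteroclinicTriggerChainTriggerChainFrontStepFlowWindows
import Summits.NavierStokesRegularity.NavierStokesRegularity.Theorems.TaoLadderRungThreeGappedFrontRobustComparison
import HarnessLib

/-!
# `HeteroclinicTriggerChain` — crux `TriggerChainFrontStep` (item stmt-NavierStokesRegularity-22785):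
  the POST-IGNITION GROWTH STAGE of the forced arc (segment form)

Between ignition (trigger `u = h` small, carrier surplus `D = x − y ≈ 1`) and the capture regime of
`…ForcedArcWithin` / `…ForcedArcExp` (trigger energy `O(1)`, then `D ≤ 0`), the trigger of the forced arc
`D′ = −2e·u² + f₁`, `u′ = e·D·u + f₂` (`|f₁|, |f₂| ≤ φ`) keeps growing EXPONENTIALLY at rate `≥ e·D_m` as long
as the surplus stays `≥ D_m`; and the surplus does stay `≥ D_m` as long as `u ≤ ū`, because the radius
`D² + 2u²` drifts by at most `6Mφt` (`heteroclinicTriggerChain_forcedArcOn_radius_drift`). So the level `ū`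
is reached within `log(ū/(u(0) − φ/(eD_m)))/(eD_m)` — the `O(log(1/h)/e)` stage that the lifespan pinch of the
certificate needs between the `log(1/β)/e` delay and the `O(1) + O(log(1/δ))/e` capture (design note of seat
ns-htc-p5, §6). Proved with the cell's `GappedFrontRobust.bootstrap_family` (continuity argument on
`(3/2)D_m − D`: weak `D ≥ D_m/2` keeps the trigger positive by `heteroclinicTriggerChain_forcedDelayOn_growth_lower`,
hence `|u| ≤ ū`, hence `D ≥ D_m` by the radius) and the first hitting time of `…FlowWindows`.
* `heteroclinicTriggerChain_forcedArcOn_growth_core` — on a window where `u ≤ ū`: `D ≥ D_m` and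
  `u(t) ≥ (u(0) − φ/(eD_m))e^{eD_m t} + φ/(eD_m)`;
* `heteroclinicTriggerChain_forcedArcOn_growth_stage` — the first time `τ` with `u(τ) = ū`, `u < ū` before,
  `D ≥ D_m` up to `τ`, and `τ ≤ log(ū/(u(0) − φ/(eD_m)))/(eD_m)`.
One-sided derivatives on the window (the regularity of `TaoCascade.PseudoFlowOn`).

HONEST FRAMING: elementary real analysis of a planar ODE with bounded forcing on a segment; helper lemmas for
the crux (no stub credit); nothing here is a statement about the Navier–Stokes equations; no summit, rung or
crux is proved. NS regularity is not proved by this line.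
-/

noncomputable section

-- the sub-problem namespace `Summit.NavierStokesRegularity.NavierStokesRegularity` repeats the summit name by design (D-0017)
set_option linter.dupNamespace false

open Real Set

namespace Summit.NavierStokesRegularity.NavierStokesRegularity.Theorems

/-- **Growth stage, core.** Forced arc on `[0, τ]` (derivatives within the segment), `|f₁|, |f₂| ≤ φ`,
`|D|, |u| ≤ M`, `u ≤ ū` on the window, radius room `D_m² + 2ū² + 6Mφτ ≤ D(0)² + 2u(0)²`, `D(0) ≥ D_m > 0`,
seed above the forcing `2φ/(eD_m) < u(0)`. Then `D ≥ D_m` on `[0, τ]` and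
`u(t) ≥ (u(0) − φ/(eD_m))·e^{eD_m t} + φ/(eD_m)` there. [folklore] -/
theorem heteroclinicTriggerChain_forcedArcOn_growth_core {e φ M τ Dm ub : ℝ} {D u f₁ f₂ : ℝ → ℝ}
    (he : 0 < e) (hDm : 0 < Dm)
    (hD : ∀ t ∈ Icc 0 τ, HasDerivWithinAt D (-(2 * e * u t ^ 2) + f₁ t) (Icc 0 τ) t)
    (hu : ∀ t ∈ Icc 0 τ, HasDerivWithinAt u (e * D t * u t + f₂ t) (Icc 0 τ) t)
    (hf₁ : ∀ t ∈ Icc 0 τ, |f₁ t| ≤ φ) (hf₂ : ∀ t ∈ Icc 0 τ, |f₂ t| ≤ φ)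
    (hDM : ∀ t ∈ Icc 0 τ, |D t| ≤ M) (huM : ∀ t ∈ Icc 0 τ, |u t| ≤ M)
    (hrad : Dm ^ 2 + 2 * ub ^ 2 + 6 * M * φ * τ ≤ D 0 ^ 2 + 2 * u 0 ^ 2)
    (hD0 : Dm ≤ D 0) (hseed : 2 * φ / (e * Dm) < u 0) (hub : ∀ t ∈ Icc 0 τ, u t ≤ ub) :
    (∀ t ∈ Icc 0 τ, Dm ≤ D t) ∧
      ∀ t ∈ Icc 0 τ, (u 0 - φ / (e * Dm)) * Real.exp (e * Dm * t) + φ / (e * Dm) ≤ u t := by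
  by_cases hτ : τ < 0
  · refine ⟨fun t ht => absurd (ht.1.trans ht.2) (not_le.2 hτ), fun t ht => absurd (ht.1.trans ht.2) (not_le.2 hτ)⟩
  push Not at hτ
  have h0mem : (0 : ℝ) ∈ Icc 0 τ := left_mem_Icc.2 hτ
  have hφ : 0 ≤ φ := le_trans (abs_nonneg _) (hf₁ 0 h0mem)
  have hM : 0 ≤ M := le_trans (abs_nonneg _) (hDM 0 h0mem)
  have hc : 0 ≤ φ / (e * Dm) := by positivity
  have hseed' : φ / (e * (Dm / 2)) < u 0 := by
    have : φ / (e * (Dm / 2)) = 2 * φ / (e * Dm) := by field_simp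
    rw [this]; exact hseed
  -- Lipschitz bound for D on the window
  have hlipD : ∀ s ∈ Icc 0 τ, ∀ t ∈ Icc 0 τ, |D t - D s| ≤ (2 * e * M ^ 2 + φ) * |t - s| := by
    intro s hs t ht
    have hb : ∀ z ∈ Icc 0 τ, ‖-(2 * e * u z ^ 2) + f₁ z‖ ≤ 2 * e * M ^ 2 + φ := by
      intro z hz
      rw [Real.norm_eq_abs]
      have h1 : u z ^ 2 ≤ M ^ 2 := by
        rw [← sq_abs (u z)]
        exact pow_le_pow_left₀ (abs_nonneg _) (huM z hz) 2
      have h2 : 0 ≤ 2 * e * u z ^ 2 := by positivity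
      have h3 : 2 * e * u z ^ 2 ≤ 2 * e * M ^ 2 := mul_le_mul_of_nonneg_left h1 (by positivity)
      have h4 := abs_le.1 (hf₁ z hz)
      rw [abs_le]; constructor <;> linarith
    have h := (convex_Icc 0 τ).norm_image_sub_le_of_norm_hasDerivWithin_le hD hb hs ht
    rw [Real.norm_eq_abs, Real.norm_eq_abs] at h
    exact h
  -- the bootstrap on (3/2) Dm − D: weak D ≥ Dm/2 ⇒ strong D ≥ Dm
  have hL : 0 ≤ (2 * e * M ^ 2 + φ) / (Dm / 2) := by positivity
  have key := GappedFrontRobust.bootstrap_family (ι := Unit) (u := fun _ t => 3 / 2 * Dm - D t)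
    (p := fun _ => Dm / 2) (ψ := fun _ => (1 : ℝ)) (τ := τ) (L := (2 * e * M ^ 2 + φ) / (Dm / 2))
    (fun _ => by positivity) hL continuousOn_const (fun _ _ => one_pos)
    (by
      intro _ s hs t ht
      have h1 : |3 / 2 * Dm - D t - (3 / 2 * Dm - D s)| = |D t - D s| := by
        rw [show 3 / 2 * Dm - D t - (3 / 2 * Dm - D s) = -(D t - D s) by ring, abs_neg]
      rw [h1]
      have h2 : (2 * e * M ^ 2 + φ) / (Dm / 2) * (Dm / 2) = 2 * e * M ^ 2 + φ := by
        field_simp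
      rw [h2]
      exact hlipD s hs t ht)
    (fun _ => by linarith)
    (by
      intro t ht hweak _
      have hsub : Icc 0 t ⊆ Icc 0 τ := Icc_subset_Icc le_rfl ht.2
      have hwD : ∀ s ∈ Icc 0 t, Dm / 2 ≤ D s := fun s hs => by
        have := hweak () s hs
        linarith
      -- the trigger stays positive on [0,t]
      have hu' : ∀ s ∈ Icc 0 t, HasDerivWithinAt u (e * D s * u s + f₂ s) (Icc 0 t) s :=
        fun s hs => (hu s (hsub hs)).mono hsub
      have hgrow := heteroclinicTriggerChain_forcedDelayOn_growth_lower he (half_pos hDm) hu'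
        (fun s hs => hf₂ s (hsub hs)) hwD hseed'
      have hupos : ∀ s ∈ Icc 0 t, 0 ≤ u s := by
        intro s hs
        have h1 := hgrow s hs
        have h2 : 0 < u 0 - φ / (e * (Dm / 2)) := by linarith
        have h3 : 1 ≤ Real.exp (e * (Dm / 2) * s) := Real.one_le_exp (by
          have := hs.1; positivity)
        have h4 : 0 ≤ φ / (e * (Dm / 2)) := by positivity
        nlinarith
      -- radius at time t
      have hdrift := heteroclinicTriggerChain_forcedArcOn_radius_drift
        (fun s hs => (hD s (hsub hs)).mono hsub) hu' (fun s hs => hf₁ s (hsub hs))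
        (fun s hs => hf₂ s (hsub hs)) (fun s hs => hDM s (hsub hs)) (fun s hs => huM s (hsub hs))
        t ⟨ht.1, le_rfl⟩
      have hrad_t := (abs_le.1 hdrift).1
      have hut : u t ^ 2 ≤ ub ^ 2 := pow_le_pow_left₀ (hupos t ⟨ht.1, le_rfl⟩) (hub t ht) 2
      have h6 : 6 * M * φ * t ≤ 6 * M * φ * τ := mul_le_mul_of_nonneg_left ht.2 (by positivity)
      have hD2 : Dm ^ 2 ≤ D t ^ 2 := by linarith
      have hDt : Dm / 2 ≤ D t := hwD t ⟨ht.1, le_rfl⟩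
      nlinarith)
  have hstrong : ∀ t ∈ Icc 0 τ, Dm ≤ D t := fun t ht => by
    have := key () t ht
    linarith
  refine ⟨hstrong, ?_⟩
  have hseed1 : φ / (e * Dm) < u 0 := by
    have : φ / (e * Dm) ≤ 2 * φ / (e * Dm) := by
      apply div_le_div_of_nonneg_right _ (by positivity)
      linarith
    exact lt_of_le_of_lt this hseed
  exact heteroclinicTriggerChain_forcedDelayOn_growth_lower he hDm hu hf₂ hstrong hseed1

/-- **POST-IGNITION GROWTH STAGE of the forced arc** (helper for item stmt-NavierStokesRegularity-22785).
Forced arc on `[0, T]` (derivatives within the segment), `|f₁|, |f₂| ≤ φ`, `|D|, |u| ≤ M`, start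
`D(0) > 0`, `0 < u(0) < ū` with the seed above the forcing `2φ/(eD_m) < u(0)`, radius room
`D_m² + 2ū² + 6MφT ≤ D(0)² + 2u(0)²` (`D_m > 0`), and horizon `T ≥ log(ū/(u(0) − φ/(eD_m)))/(eD_m)`. Then
the trigger reaches the level `ū` at a first time `τ ∈ (0, T]`, `u < ū` on `[0, τ)`, the carrier surplus
satisfies `D ≥ D_m` on `[0, τ]`, and `τ ≤ log(ū/(u(0) − φ/(eD_m)))/(eD_m)`. [folklore] -/
theorem heteroclinicTriggerChain_forcedArcOn_growth_stage {e φ M T Dm ub : ℝ} {D u f₁ f₂ : ℝ → ℝ}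
    (he : 0 < e) (hDm : 0 < Dm) (hT : 0 ≤ T)
    (hD : ∀ t ∈ Icc 0 T, HasDerivWithinAt D (-(2 * e * u t ^ 2) + f₁ t) (Icc 0 T) t)
    (hu : ∀ t ∈ Icc 0 T, HasDerivWithinAt u (e * D t * u t + f₂ t) (Icc 0 T) t)
    (hf₁ : ∀ t ∈ Icc 0 T, |f₁ t| ≤ φ) (hf₂ : ∀ t ∈ Icc 0 T, |f₂ t| ≤ φ)
    (hDM : ∀ t ∈ Icc 0 T, |D t| ≤ M) (huM : ∀ t ∈ Icc 0 T, |u t| ≤ M)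
    (hrad : Dm ^ 2 + 2 * ub ^ 2 + 6 * M * φ * T ≤ D 0 ^ 2 + 2 * u 0 ^ 2)
    (hD0 : 0 < D 0) (hu0 : 0 < u 0) (hub0 : u 0 < ub) (hseed : 2 * φ / (e * Dm) < u 0)
    (hTA : Real.log (ub / (u 0 - φ / (e * Dm))) / (e * Dm) ≤ T) :
    ∃ τ ∈ Ioc 0 T, u τ = ub ∧ (∀ t ∈ Ico 0 τ, u t < ub) ∧ (∀ t ∈ Icc 0 τ, Dm ≤ D t) ∧
      τ ≤ Real.log (ub / (u 0 - φ / (e * Dm))) / (e * Dm) := by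
  have h0mem : (0 : ℝ) ∈ Icc 0 T := left_mem_Icc.2 hT
  have hφ : 0 ≤ φ := le_trans (abs_nonneg _) (hf₁ 0 h0mem)
  have hM : 0 ≤ M := le_trans (abs_nonneg _) (hDM 0 h0mem)
  have hc : 0 ≤ φ / (e * Dm) := by positivity
  have huc : 0 < u 0 - φ / (e * Dm) := by
    have : φ / (e * Dm) ≤ 2 * φ / (e * Dm) := by
      apply div_le_div_of_nonneg_right _ (by positivity); linarith
    linarith
  have hquot : 0 < ub / (u 0 - φ / (e * Dm)) := div_pos (hu0.trans hub0) huc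
  -- D(0) ≥ Dm from the radius room
  have hD0m : Dm ≤ D 0 := by
    have h1 : u 0 ^ 2 ≤ ub ^ 2 := pow_le_pow_left₀ hu0.le hub0.le 2
    have h2 : 0 ≤ 6 * M * φ * T := by positivity
    have h3 : Dm ^ 2 ≤ D 0 ^ 2 := by linarith
    nlinarith
  -- the core on a sub-window [0, τ'] where u ≤ ū
  have hcore : ∀ τ', τ' ∈ Icc 0 T → (∀ t ∈ Icc 0 τ', u t ≤ ub) →
      (∀ t ∈ Icc 0 τ', Dm ≤ D t) ∧
        ∀ t ∈ Icc 0 τ', (u 0 - φ / (e * Dm)) * Real.exp (e * Dm * t) + φ / (e * Dm) ≤ u t := by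
    intro τ' hτ' hub
    have hsub : Icc 0 τ' ⊆ Icc 0 T := Icc_subset_Icc le_rfl hτ'.2
    have hrad' : Dm ^ 2 + 2 * ub ^ 2 + 6 * M * φ * τ' ≤ D 0 ^ 2 + 2 * u 0 ^ 2 := by
      have : 6 * M * φ * τ' ≤ 6 * M * φ * T := mul_le_mul_of_nonneg_left hτ'.2 (by positivity)
      linarith
    exact heteroclinicTriggerChain_forcedArcOn_growth_core he hDm
      (fun s hs => (hD s (hsub hs)).mono hsub) (fun s hs => (hu s (hsub hs)).mono hsub)
      (fun s hs => hf₁ s (hsub hs)) (fun s hs => hf₂ s (hsub hs)) (fun s hs => hDM s (hsub hs))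
      (fun s hs => huM s (hsub hs)) hrad' hD0m hseed hub
  -- the growth bound forces the level ū by the time log(ū/(u0 − c))/(eDm)
  have hreach : ∀ t, 0 ≤ t → Real.log (ub / (u 0 - φ / (e * Dm))) / (e * Dm) ≤ t →
      ub ≤ (u 0 - φ / (e * Dm)) * Real.exp (e * Dm * t) + φ / (e * Dm) := by
    intro t ht0 ht
    have h1 : Real.log (ub / (u 0 - φ / (e * Dm))) ≤ e * Dm * t := by
      rw [div_le_iff₀ (by positivity)] at ht; linarith
    have h2 : ub / (u 0 - φ / (e * Dm)) ≤ Real.exp (e * Dm * t) := by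
      rw [← Real.log_le_iff_le_exp hquot]; exact h1
    have h3 : ub ≤ (u 0 - φ / (e * Dm)) * Real.exp (e * Dm * t) := by
      rw [div_le_iff₀ huc] at h2; linarith
    linarith
  by_cases hex : ∃ t ∈ Icc 0 T, ub ≤ u t
  · obtain ⟨t₀, ht₀, hut₀⟩ := hex
    have hcont : ContinuousOn u (Icc 0 t₀) := fun s hs =>
      ((hu s ⟨hs.1, hs.2.trans ht₀.2⟩).continuousWithinAt).mono (Icc_subset_Icc le_rfl ht₀.2)
    obtain ⟨τ, hτ, huτ, hbefore⟩ := htcFW_first_hitting_time ht₀.1 hcont hub0 hut₀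
    have hτT : τ ∈ Icc 0 T := ⟨hτ.1.le, hτ.2.trans ht₀.2⟩
    have hle : ∀ t ∈ Icc 0 τ, u t ≤ ub := by
      intro t ht
      rcases ht.2.eq_or_lt with h | h
      · rw [h, huτ]
      · exact (hbefore t ⟨ht.1, h⟩).le
    obtain ⟨hDge, hgrow⟩ := hcore τ hτT hle
    refine ⟨τ, ⟨hτ.1, hτ.2.trans ht₀.2⟩, huτ, hbefore, hDge, ?_⟩
    -- if τ exceeded the bound, u would have reached ū strictly before τ
    by_contra hcon
    push Not at hcon
    set tA : ℝ := Real.log (ub / (u 0 - φ / (e * Dm))) / (e * Dm) with htA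
    have htA0 : 0 ≤ tA := by
      rcases le_or_gt 0 tA with h | h
      · exact h
      · -- tA < 0 < τ: then u 0 ≥ ū already, contradiction
        exfalso
        have := hreach 0 le_rfl h.le
        simp only [mul_zero, Real.exp_zero, mul_one] at this
        linarith
    have h1 := hgrow tA ⟨htA0, hcon.le⟩
    have h2 := hreach tA htA0 le_rfl
    have h3 := hbefore tA ⟨htA0, hcon⟩
    linarith
  · push Not at hex
    obtain ⟨-, hgrow⟩ := hcore T ⟨hT, le_rfl⟩ (fun t ht => (hex t ht).le)
    have h1 := hgrow T ⟨hT, le_rfl⟩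
    have h2 := hreach T hT hTA
    have h3 := hex T ⟨hT, le_rfl⟩
    exfalso
    linarith

end Summit.NavierStokesRegularity.NavierStokesRegularity.Theorems

end
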